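import Literature.Computability.QuantumComplexity.ZXCalculusC1
import HarnessLib

/-!
# `ZX_{π/4}` modulo the calculus: JPV's Lemma C1-bis (the Hadamard wire between the red nodes)

Topic `Literature/Computability/QuantumComplexity`, continuing `ZXCalculusC1.lean` (layer T3 of
the formalisation of `JeandelPerdrixVilmart2018_completeness`).

* the `CZ` gadget with a Hadamard edge `E = (Z^{(1,2)} ⊗ Z^{(1,2)}) ⨾ (𝕀 ⊗ H-cap ⊗ 𝕀)`: its
  merge forms (`czGadget_eq_hedgeSq`, `czGadgetMirror_eq_hedgeSq`), its symmetry under the crossing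
  (`swap_seq_czGadget`), phases through it (`hedgeSq_seq_phases`, `phases_seq_hedgeSq`), and its
  square: `√2 ⊗ √2 ⊗ (E ⨾ E) = 𝕀 ⊗ 𝕀` by the Hopf law with two Hadamard wires
  (`sqrt_two_sq_par_hedgeSq_seq_hedgeSq`);
* **LMCS Lemma 18 = JPV's Lemma (C1-bis)** (`c1bis`): in front of the gadget "green `α`, `β` on
  two wires, red `π` with a green `α` leaf and red node with a green `β` leaf, green merge", the
  two red nodes on the inputs joined by a Hadamard wire (with the scalar `√2`) can be removed.
  Printed proof: the square lemma for (C1) (`xsplits_hWire_eq_square`), Lemma (C1)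
  (`c1Gadget_eq_mirror`), `H ∘ H = 𝕀`, (H), `2 = √2²`, Hopf.

## References

* E. Jeandel, S. Perdrix, R. Vilmart, LMCS 16(2):11 (2020) (arXiv:1903.06035), App. A, Lemma 18
  (`lem:C1-bis`) and its proof figure `control-commutation-3-proof` [JeandelPerdrixVilmart2018].
-/

noncomputable section

namespace Literature.Computability.QuantumComplexity

open ZXDiagram ZXClass

namespace ZXClass

/-! ### The crossing and `1 → 1` maps; the side of a leaf -/

/-- Naturality of the crossing for two `1 → 1` maps: `σ ⨾ (A ⊗ B) = (B ⊗ A) ⨾ σ`. [cite: JeandelPerdrixVilmart2018, §2.2] -/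
theorem swap_seq_par_one_one (A B : ZXClass 1 1) : mk swap ⨟ (A ⊠ B) = (B ⊠ A) ⨟ mk swap := by
  have hA : mk swap ⨟ (A ⊠ mk (wires 1)) = (mk (wires 1) ⊠ A) ⨟ mk swap := by
    have h := fswap1_nat A
    rwa [fswap1_one] at h
  have hB : mk swap ⨟ (mk (wires 1) ⊠ B) = (B ⊠ mk (wires 1)) ⨟ mk swap := by
    have h := swap_nat B
    rw [bswap1_one] at h
    exact h.symm
  rw [par_eq_seq_left A B, ← seq_assoc, hA, seq_assoc, hB, ← seq_assoc, ← par_eq_seq_right]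

/-- The crossing before an effect on the first wire is the effect on the second wire. [cite: JeandelPerdrixVilmart2018, §2.2] -/
theorem swap_seq_effect_par (E : ZXClass 1 0) : mk swap ⨟ (E ⊠ mk (wires 1)) = mk (wires 1) ⊠ E := by
  have h := swap_nat E
  rw [bswap1_one, bswap1_zero, seq_id] at h
  rw [h, ← seq_assoc, swap_seq_swap, id_seq]

/-- The leaf of JPV's `xLeaf` gadgets may hang on either output of the red node:
`X^{(1,2)}(k) ⨾ (Z^{(1,0)}(l) ⊗ 𝕀) = X^{(1,2)}(k) ⨾ (𝕀 ⊗ Z^{(1,0)}(l))`. [cite: JeandelPerdrixVilmart2018, Fig. 1] -/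
theorem xLeafL_eq_xLeafR (k l : ZMod 8) : mk (xLeafL k l) = mk (xLeafR k l) := by
  simp only [xLeafL, xLeafR, mk_seq, mk_par]
  rw [← swap_seq_effect_par, ← seq_assoc, X_seq_swap]

/-! ### The `CZ` gadget with a Hadamard edge -/

/-- The `CZ` gadget as drawn in `xsplits_hWire_eq_square` (copy on the first wire, merge on the
second) is the symmetric cap form `(Z^{(1,2)} ⊗ Z^{(1,2)}) ⨾ (𝕀 ⊗ H-cap ⊗ 𝕀)`. [cite: JeandelPerdrixVilmart2018, §2.2] -/
theorem czGadget_eq_hedgeSq :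
    (mk (Z 1 2 0) ⊠ mk (wires 1)) ⨟ ((mk (wires 1) ⊠ mk hBox) ⊠ mk (wires 1)) ⨟ (mk (wires 1) ⊠ mk (Z 2 1 0)) =
      (mk (Z 1 2 0) ⊠ mk (Z 1 2 0)) ⨟ ((mk (wires 1) ⊠ ((mk hBox ⊠ mk (wires 1)) ⨟ mk cap)) ⊠ mk (wires 1)) := by
  have h := split_hBox_par_hBox_seq_par_merge 0 0
  -- strip the Hadamard on the second input from both sides of `h`
  have h' : (mk (wires 1) ⊠ mk hBox) ⨟ (((mk (Z 1 2 0) ⨟ (mk (wires 1) ⊠ mk hBox)) ⊠ mk hBox) ⨟ (mk (wires 1) ⊠ mk (Z 2 1 0))) =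
      (mk (wires 1) ⊠ mk hBox) ⨟ ((mk (wires 1) ⊠ mk hBox) ⨟ (mk (Z 1 2 0) ⊠ mk (Z 1 2 0)) ⨟
        ((mk (wires 1) ⊠ ((mk hBox ⊠ mk (wires 1)) ⨟ mk cap)) ⊠ mk (wires 1))) := by rw [h]
  simp only [seq_assoc] at h'
  rw [← seq_assoc (mk (wires 1) ⊠ mk hBox) (mk (wires 1) ⊠ mk hBox), par_hBox_seq_par_hBox, id_seq,
    ← seq_assoc (mk (wires 1) ⊠ mk hBox) ((mk (Z 1 2 0) ⨟ (mk (wires 1) ⊠ mk hBox)) ⊠ mk hBox),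
    show (mk (wires 1) ⊠ mk hBox) ⨟ ((mk (Z 1 2 0) ⨟ (mk (wires 1) ⊠ mk hBox)) ⊠ mk hBox) =
        (mk (Z 1 2 0) ⨟ (mk (wires 1) ⊠ mk hBox)) ⊠ mk (wires 1) from by
      rw [par_eq_seq_right (mk (Z 1 2 0) ⨟ (mk (wires 1) ⊠ mk hBox)) (mk hBox), ← seq_assoc, par_hBox_seq_par_hBox, id_seq],
    seq_par_wires] at h'
  simpa only [seq_assoc] using h'

/-- The mirror drawing (copy on the second wire, merge on the first) is the same cap form. [cite: JeandelPerdrixVilmart2018, §2.2] -/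
theorem czGadgetMirror_eq_hedgeSq :
    (mk (wires 1) ⊠ (mk (Z 1 2 0) ⨟ (mk hBox ⊠ mk (wires 1)))) ⨟ (mk (Z 2 1 0) ⊠ mk (wires 1)) =
      (mk (Z 1 2 0) ⊠ mk (Z 1 2 0)) ⨟ ((mk (wires 1) ⊠ ((mk hBox ⊠ mk (wires 1)) ⨟ mk cap)) ⊠ mk (wires 1)) := by
  have h := hBox_par_split_hBox_seq_merge 0 0
  have h' : (mk hBox ⊠ mk (wires 1)) ⨟ ((mk hBox ⊠ (mk (Z 1 2 0) ⨟ (mk hBox ⊠ mk (wires 1)))) ⨟ (mk (Z 2 1 0) ⊠ mk (wires 1))) =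
      (mk hBox ⊠ mk (wires 1)) ⨟ ((mk hBox ⊠ mk (wires 1)) ⨟ (mk (Z 1 2 0) ⊠ mk (Z 1 2 0)) ⨟
        ((mk (wires 1) ⊠ ((mk hBox ⊠ mk (wires 1)) ⨟ mk cap)) ⊠ mk (wires 1))) := by rw [h]
  simp only [seq_assoc] at h'
  rw [← seq_assoc (mk hBox ⊠ mk (wires 1)) (mk hBox ⊠ mk (wires 1)), hBox_par_seq_hBox_par, id_seq,
    ← seq_assoc (mk hBox ⊠ mk (wires 1)) (mk hBox ⊠ (mk (Z 1 2 0) ⨟ (mk hBox ⊠ mk (wires 1)))),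
    show (mk hBox ⊠ mk (wires 1)) ⨟ (mk hBox ⊠ (mk (Z 1 2 0) ⨟ (mk hBox ⊠ mk (wires 1)))) =
        mk (wires 1) ⊠ (mk (Z 1 2 0) ⨟ (mk hBox ⊠ mk (wires 1))) from by
      rw [par_eq_seq_left (mk hBox) (mk (Z 1 2 0) ⨟ (mk hBox ⊠ mk (wires 1))), ← seq_assoc, hBox_par_seq_hBox_par, id_seq]] at h'
  simpa only [seq_assoc] using h'

/-- **The `CZ` gadget is symmetric**: it commutes with the crossing. [cite: JeandelPerdrixVilmart2018, §2.2] -/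
theorem swap_seq_czGadget :
    mk swap ⨟ ((mk (Z 1 2 0) ⊠ mk (wires 1)) ⨟ ((mk (wires 1) ⊠ mk hBox) ⊠ mk (wires 1)) ⨟ (mk (wires 1) ⊠ mk (Z 2 1 0))) =
      ((mk (Z 1 2 0) ⊠ mk (wires 1)) ⨟ ((mk (wires 1) ⊠ mk hBox) ⊠ mk (wires 1)) ⨟ (mk (wires 1) ⊠ mk (Z 2 1 0))) ⨟ mk swap := by
  -- conjugate by the crossing: `σ ⨾ CZg ⨾ σ = CZg_mirror = CZg`
  suffices h : mk swap ⨟ ((mk (Z 1 2 0) ⊠ mk (wires 1)) ⨟ ((mk (wires 1) ⊠ mk hBox) ⊠ mk (wires 1)) ⨟ (mk (wires 1) ⊠ mk (Z 2 1 0))) ⨟ mk swap =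
      (mk (Z 1 2 0) ⊠ mk (wires 1)) ⨟ ((mk (wires 1) ⊠ mk hBox) ⊠ mk (wires 1)) ⨟ (mk (wires 1) ⊠ mk (Z 2 1 0)) by
    have h2 := congrArg (· ⨟ mk swap) h
    simp only [seq_assoc, swap_seq_swap, seq_id] at h2
    simpa only [seq_assoc] using h2
  -- σ ⨾ (Z12 ⊗ 𝕀) = (𝕀 ⊗ Z12) ⨾ (σ ⊗ 𝕀) ⨾ (𝕀 ⊗ σ)
  have h1 : mk swap ⨟ (mk (Z 1 2 0) ⊠ mk (wires 1)) = (mk (wires 1) ⊠ mk (Z 1 2 0)) ⨟ (mk swap ⊠ mk (wires 1)) ⨟ (mk (wires 1) ⊠ mk swap) := by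
    have h := fswap1_nat (mk (Z 1 2 0))
    rw [fswap1_one, fswap1_two, ← seq_assoc] at h
    exact h
  -- (𝕀 ⊗ σ) ⨾ ((𝕀 ⊗ H) ⊗ 𝕀) = (𝕀² ⊗ H) ⨾ (𝕀 ⊗ σ)
  have h2 : (mk (wires 1) ⊠ mk swap) ⨟ ((mk (wires 1) ⊠ mk hBox) ⊠ mk (wires 1)) = (mk (wires 2) ⊠ mk hBox) ⨟ (mk (wires 1) ⊠ mk swap) := by
    rw [show (mk (wires 1) ⊠ mk hBox) ⊠ mk (wires 1) = mk (wires 1) ⊠ (mk hBox ⊠ mk (wires 1)) from (par_assoc _ _ _).trans (cast_id _ _ _),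
      ← wires_par_seq, swap_seq_par_one_one, wires_par_seq, ← wires_par_wires 1 1]
    congr 1
    exact (par_assoc' _ _ _).trans (cast_id _ _ _)
  -- (σ ⊗ 𝕀) ⨾ (𝕀² ⊗ H) = (𝕀² ⊗ H) ⨾ (σ ⊗ 𝕀)  (disjoint wires)
  have h3 : (mk swap ⊠ mk (wires 1)) ⨟ (mk (wires 2) ⊠ mk hBox) = (mk (wires 2) ⊠ mk hBox) ⨟ (mk swap ⊠ mk (wires 1)) := by
    rw [interchange, seq_id, id_seq, interchange, seq_id, id_seq]
  -- (σ ⊗ 𝕀) ⨾ (𝕀 ⊗ Z21) ⨾ σ = (𝕀 ⊗ σ) ⨾ (Z21 ⊗ 𝕀)  (spider naturality)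
  have h4 : (mk swap ⊠ mk (wires 1)) ⨟ (mk (wires 1) ⊠ mk (Z 2 1 0)) ⨟ mk swap = (mk (wires 1) ⊠ mk swap) ⨟ (mk (Z 2 1 0) ⊠ mk (wires 1)) := by
    have h := Rule.spider_nat.eq
    simp only [mk_seq, mk_par] at h
    -- h : ((𝕀 ⊗ σ) ⨾ (σ ⊗ 𝕀)) ⨾ (𝕀 ⊗ Z21) = (Z21 ⊗ 𝕀) ⨾ σ
    have h5 : (mk swap ⊠ mk (wires 1)) ⨟ (mk (wires 1) ⊠ mk (Z 2 1 0)) = (mk (wires 1) ⊠ mk swap) ⨟ (mk (Z 2 1 0) ⊠ mk (wires 1)) ⨟ mk swap := by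
      have h6 : (mk (wires 1) ⊠ mk swap) ⨟ ((mk (wires 1) ⊠ mk swap) ⨟ (mk swap ⊠ mk (wires 1)) ⨟ (mk (wires 1) ⊠ mk (Z 2 1 0))) =
          (mk (wires 1) ⊠ mk swap) ⨟ ((mk (Z 2 1 0) ⊠ mk (wires 1)) ⨟ mk swap) := by rw [h]
      simp only [← seq_assoc] at h6
      rwa [wires_par_swap_seq_self, id_seq] at h6
    rw [h5, seq_assoc _ (mk swap) (mk swap), swap_seq_swap, seq_id]
  -- assemble on the left-nested spine
  simp only [← seq_assoc]
  rw [h1, seq_assoc _ (mk (wires 1) ⊠ mk swap) ((mk (wires 1) ⊠ mk hBox) ⊠ mk (wires 1)), h2]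
  simp only [← seq_assoc]
  rw [seq_assoc _ (mk swap ⊠ mk (wires 1)) (mk (wires 2) ⊠ mk hBox), h3]
  simp only [← seq_assoc]
  rw [seq_assoc _ (mk (wires 1) ⊠ mk swap) (mk (wires 1) ⊠ mk (Z 2 1 0)), ← wires_par_seq, swap_spider,
    seq_assoc _ (mk swap ⊠ mk (wires 1)) (mk (wires 1) ⊠ mk (Z 2 1 0)),
    seq_assoc _ ((mk swap ⊠ mk (wires 1)) ⨟ (mk (wires 1) ⊠ mk (Z 2 1 0))) (mk swap), h4]
  simp only [← seq_assoc]
  rw [← wires_par_wires 1 1,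
    show (mk (wires 1) ⊠ mk (wires 1)) ⊠ mk hBox = mk (wires 1) ⊠ (mk (wires 1) ⊠ mk hBox) from (par_assoc _ _ _).trans (cast_id _ _ _),
    ← wires_par_seq, ← wires_par_seq, seq_assoc (mk (Z 1 2 0)), ← swap_seq_par_one_one, ← seq_assoc (mk (Z 1 2 0)), Z_seq_swap,
    czGadgetMirror_eq_hedgeSq, ← czGadget_eq_hedgeSq]

/-- The symmetric `CZ` gadget commutes with the crossing (all-left-nested form). [cite: JeandelPerdrixVilmart2018, §2.2] -/
theorem swap_seq_czGadget' :
    mk swap ⨟ (mk (Z 1 2 0) ⊠ mk (wires 1)) ⨟ ((mk (wires 1) ⊠ mk hBox) ⊠ mk (wires 1)) ⨟ (mk (wires 1) ⊠ mk (Z 2 1 0)) =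
      (mk (Z 1 2 0) ⊠ mk (wires 1)) ⨟ ((mk (wires 1) ⊠ mk hBox) ⊠ mk (wires 1)) ⨟ (mk (wires 1) ⊠ mk (Z 2 1 0)) ⨟ mk swap := by
  simpa only [seq_assoc] using swap_seq_czGadget

/-! ### Phases through the gadget; its square -/

/-- Phases before the copies of the cap-form gadget enter the copies. [cite: JeandelPerdrixVilmart2018, Fig. 1 (S1)] -/
theorem phases_seq_hedgeSq (a b : ZMod 8) :
    (mk (Z 1 1 a) ⊠ mk (Z 1 1 b)) ⨟ ((mk (Z 1 2 0) ⊠ mk (Z 1 2 0)) ⨟ ((mk (wires 1) ⊠ ((mk hBox ⊠ mk (wires 1)) ⨟ mk cap)) ⊠ mk (wires 1))) =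
      (mk (Z 1 2 a) ⊠ mk (Z 1 2 b)) ⨟ ((mk (wires 1) ⊠ ((mk hBox ⊠ mk (wires 1)) ⨟ mk cap)) ⊠ mk (wires 1)) := by
  rw [← seq_assoc, interchange, Z_seq_Z 1 1 2 le_rfl, Z_seq_Z 1 1 2 le_rfl, add_zero a, add_zero b]

/-- Phases after the cap-form gadget enter the copies as well. [cite: JeandelPerdrixVilmart2018, Fig. 1 (S1)] -/
theorem hedgeSq_seq_phases (a b : ZMod 8) :
    ((mk (Z 1 2 0) ⊠ mk (Z 1 2 0)) ⨟ ((mk (wires 1) ⊠ ((mk hBox ⊠ mk (wires 1)) ⨟ mk cap)) ⊠ mk (wires 1))) ⨟ (mk (Z 1 1 a) ⊠ mk (Z 1 1 b)) =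
      (mk (Z 1 2 a) ⊠ mk (Z 1 2 b)) ⨟ ((mk (wires 1) ⊠ ((mk hBox ⊠ mk (wires 1)) ⨟ mk cap)) ⊠ mk (wires 1)) := by
  -- the phases slide up the outer legs, past the cap on the middle legs
  have hc : ((mk (wires 1) ⊠ ((mk hBox ⊠ mk (wires 1)) ⨟ mk cap)) ⊠ mk (wires 1)) ⨟ (mk (Z 1 1 a) ⊠ mk (Z 1 1 b)) =
      ((mk (Z 1 1 a) ⊠ mk (wires 2)) ⊠ mk (Z 1 1 b)) ⨟ ((mk (wires 1) ⊠ ((mk hBox ⊠ mk (wires 1)) ⨟ mk cap)) ⊠ mk (wires 1)) := by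
    rw [interchange, id_seq, ← par_empty (mk (Z 1 1 a)), ← par_eq_seq_right, par_empty, par_eq_seq_left (mk (Z 1 1 a)),
      ← seq_id (mk (Z 1 1 b)), ← interchange, seq_id]
  rw [seq_assoc, hc, ← seq_assoc, ← wires_par_wires 1 1,
    show (mk (Z 1 1 a) ⊠ (mk (wires 1) ⊠ mk (wires 1))) ⊠ mk (Z 1 1 b) = (mk (Z 1 1 a) ⊠ mk (wires 1)) ⊠ (mk (wires 1) ⊠ mk (Z 1 1 b)) from by
      rw [show mk (Z 1 1 a) ⊠ (mk (wires 1) ⊠ mk (wires 1)) = (mk (Z 1 1 a) ⊠ mk (wires 1)) ⊠ mk (wires 1)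
        from (par_assoc' _ _ _).trans (cast_id _ _ _)]; exact (par_assoc _ _ _).trans (cast_id _ _ _),
    interchange, Z_seq_Z_par 1 1 1 1 le_rfl, Z_seq_par_Z 1 1 1 1 le_rfl, add_zero a, zero_add b]

/-- A scalar enters the middle block of `𝕀 ⊗ (X ⊗ 𝕀)`. [folklore] -/
theorem scalar_par_wire_par_par_wire (s : ZXClass 0 0) (X : ZXClass 1 1) :
    s ⊠ (mk (wires 1) ⊠ (X ⊠ mk (wires 1))) = mk (wires 1) ⊠ ((s ⊠ X) ⊠ mk (wires 1)) := by
  rw [show s ⊠ (mk (wires 1) ⊠ (X ⊠ mk (wires 1))) = (s ⊠ mk (wires 1)) ⊠ (X ⊠ mk (wires 1)) from (par_assoc' _ _ _).trans (cast_id _ _ _),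
    scalar_par_wires, show (mk (wires 1) ⊠ s) ⊠ (X ⊠ mk (wires 1)) = mk (wires 1) ⊠ (s ⊠ (X ⊠ mk (wires 1))) from (par_assoc _ _ _).trans (cast_id _ _ _),
    show s ⊠ (X ⊠ mk (wires 1)) = (s ⊠ X) ⊠ mk (wires 1) from (par_assoc' _ _ _).trans (cast_id _ _ _)]

/-- Two merges, each fed through a Hadamard, into the same wire: the Hadamard legs merge first.
`(𝕀 ⊗ ((H ⊗ 𝕀) ⨾ Z^{(2,1)})) ⨾ (H ⊗ 𝕀) ⨾ Z^{(2,1)} = (((H ⊗ H) ⨾ Z^{(2,1)}) ⊗ 𝕀) ⨾ Z^{(2,1)}`. [cite: JeandelPerdrixVilmart2018, Fig. 1 (S1)] -/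
theorem hMerge_seq_hMerge :
    (mk (wires 1) ⊠ ((mk hBox ⊠ mk (wires 1)) ⨟ mk (Z 2 1 0))) ⨟ ((mk hBox ⊠ mk (wires 1)) ⨟ mk (Z 2 1 0)) =
      (((mk hBox ⊠ mk hBox) ⨟ mk (Z 2 1 0)) ⊠ mk (wires 1)) ⨟ mk (Z 2 1 0) := by
    rw [wires_par_seq, seq_assoc, ← seq_assoc (mk (wires 1) ⊠ mk (Z 2 1 0)), ← par_eq_seq_right, par_eq_seq_left (mk hBox) (mk (Z 2 1 0)),
      seq_assoc, ← Z_three_one_eq_par_merge_merge, ← seq_assoc,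
      show mk (wires 1) ⊠ (mk hBox ⊠ mk (wires 1)) = (mk (wires 1) ⊠ mk hBox) ⊠ mk (wires 1) from (par_assoc' _ _ _).trans (cast_id _ _ _),
      ← wires_par_wires 1 1, show mk hBox ⊠ (mk (wires 1) ⊠ mk (wires 1)) = (mk hBox ⊠ mk (wires 1)) ⊠ mk (wires 1)
        from (par_assoc' _ _ _).trans (cast_id _ _ _), ← seq_par_wires, interchange, id_seq, seq_id,
      Z_three_one_eq_merge_par_merge, ← seq_assoc, ← seq_par_wires]

/-- **The square of the `CZ` gadget**: two parallel Hadamard edges between two green nodes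
disconnect (Hopf law with Hadamard wires), consuming `√2 ⊗ √2`: `√2 ⊗ √2 ⊗ (CZg ⨾ CZg) = 𝕀²`.
[cite: JeandelPerdrixVilmart2018, Appendix Lemmas 2, 3, 18 (proof)] -/
theorem sqrt_two_sq_par_czGadget_seq_czGadget :
    mk (dumbbell 0 0) ⊠ (mk (dumbbell 0 0) ⊠
      (((mk (Z 1 2 0) ⊠ mk (wires 1)) ⨟ ((mk (wires 1) ⊠ mk hBox) ⊠ mk (wires 1)) ⨟ (mk (wires 1) ⊠ mk (Z 2 1 0))) ⨟
       ((mk (Z 1 2 0) ⊠ mk (wires 1)) ⨟ ((mk (wires 1) ⊠ mk hBox) ⊠ mk (wires 1)) ⨟ (mk (wires 1) ⊠ mk (Z 2 1 0))))) = mk (wires 2) := by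
  -- reshape `CZg ⨾ CZg` into `(Z12 ⊗ 𝕀) ⨾ (𝕀 ⊗ ((Z12 ⨾ (H ⊗ H) ⨾ Z21) ⊗ 𝕀)) ⨾ (𝕀 ⊗ Z21)`
  have hshape : ((mk (Z 1 2 0) ⊠ mk (wires 1)) ⨟ ((mk (wires 1) ⊠ mk hBox) ⊠ mk (wires 1)) ⨟ (mk (wires 1) ⊠ mk (Z 2 1 0))) ⨟
      ((mk (Z 1 2 0) ⊠ mk (wires 1)) ⨟ ((mk (wires 1) ⊠ mk hBox) ⊠ mk (wires 1)) ⨟ (mk (wires 1) ⊠ mk (Z 2 1 0))) =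
      (mk (Z 1 2 0) ⊠ mk (wires 1)) ⨟ (mk (wires 1) ⊠ ((mk (Z 1 2 0) ⨟ (mk hBox ⊠ mk hBox) ⨟ mk (Z 2 1 0)) ⊠ mk (wires 1))) ⨟
        (mk (wires 1) ⊠ mk (Z 2 1 0)) := by
    simp only [← seq_assoc]
    -- slide the second copy up past the first merge and the first Hadamard
    rw [seq_assoc _ (mk (wires 1) ⊠ mk (Z 2 1 0)) (mk (Z 1 2 0) ⊠ mk (wires 1)), ← slide (mk (Z 1 2 0)) (mk (Z 2 1 0))]
    simp only [← seq_assoc]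
    rw [seq_assoc _ ((mk (wires 1) ⊠ mk hBox) ⊠ mk (wires 1)) (mk (Z 1 2 0) ⊠ mk (wires 2)),
      show ((mk (wires 1) ⊠ mk hBox) ⊠ mk (wires 1)) ⨟ (mk (Z 1 2 0) ⊠ mk (wires 2)) = (mk (Z 1 2 0) ⊠ mk (wires 2)) ⨟ (mk (wires 2) ⊠ (mk hBox ⊠ mk (wires 1))) from by
        rw [show (mk (wires 1) ⊠ mk hBox) ⊠ mk (wires 1) = mk (wires 1) ⊠ (mk hBox ⊠ mk (wires 1)) from (par_assoc _ _ _).trans (cast_id _ _ _),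
          ← slide]]
    simp only [← seq_assoc]
    -- fuse the two copies on the first wire and un-fuse them the other way
    rw [show (mk (Z 1 2 0) ⊠ mk (wires 1)) ⨟ (mk (Z 1 2 0) ⊠ mk (wires 2)) = (mk (Z 1 2 0) ⊠ mk (wires 1)) ⨟ ((mk (wires 1) ⊠ mk (Z 1 2 0)) ⊠ mk (wires 1)) from by
        rw [← wires_par_wires 1 1, show mk (Z 1 2 0) ⊠ (mk (wires 1) ⊠ mk (wires 1)) = (mk (Z 1 2 0) ⊠ mk (wires 1)) ⊠ mk (wires 1)
              from (par_assoc' _ _ _).trans (cast_id _ _ _), ← seq_par_wires, ← seq_par_wires, Z_seq_Z_par 1 1 1 2 le_rfl,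
            Z_seq_par_Z 1 1 1 2 le_rfl]]
    -- group the two Hadamard merges on the last three wires
    rw [seq_assoc _ (mk (wires 2) ⊠ (mk hBox ⊠ mk (wires 1))) (mk (wires 2) ⊠ mk (Z 2 1 0)), ← wires_par_seq,
      show (mk (wires 1) ⊠ mk hBox) ⊠ mk (wires 1) = mk (wires 1) ⊠ (mk hBox ⊠ mk (wires 1)) from (par_assoc _ _ _).trans (cast_id _ _ _),
      seq_assoc _ (mk (wires 1) ⊠ (mk hBox ⊠ mk (wires 1))) (mk (wires 1) ⊠ mk (Z 2 1 0)), ← wires_par_seq,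
      ← wires_par_wires 1 1,
      show (mk (wires 1) ⊠ mk (wires 1)) ⊠ ((mk hBox ⊠ mk (wires 1)) ⨟ mk (Z 2 1 0)) = mk (wires 1) ⊠ (mk (wires 1) ⊠ ((mk hBox ⊠ mk (wires 1)) ⨟ mk (Z 2 1 0)))
        from (par_assoc _ _ _).trans (cast_id _ _ _),
      seq_assoc _ (mk (wires 1) ⊠ (mk (wires 1) ⊠ ((mk hBox ⊠ mk (wires 1)) ⨟ mk (Z 2 1 0)))), ← wires_par_seq, hMerge_seq_hMerge,
      wires_par_seq, show (mk (wires 1) ⊠ mk (Z 1 2 0)) ⊠ mk (wires 1) = mk (wires 1) ⊠ (mk (Z 1 2 0) ⊠ mk (wires 1)) from (par_assoc _ _ _).trans (cast_id _ _ _)]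
    simp only [← seq_assoc]
    rw [seq_assoc _ (mk (wires 1) ⊠ (mk (Z 1 2 0) ⊠ mk (wires 1))), ← wires_par_seq, ← seq_par_wires, ← seq_assoc]
  -- the Hopf law with two Hadamard wires in the middle block
  rw [hshape, scalar_par_seq_seq, scalar_par_seq_seq, empty_par, cast_id, empty_par, cast_id, empty_par, cast_id, empty_par, cast_id,
    scalar_par_wire_par_par_wire, scalar_par_wire_par_par_wire, hopf_hBox, seq_par_wires, wires_par_seq, ← seq_assoc,
    show mk (wires 1) ⊠ (mk (Z 1 0 0) ⊠ mk (wires 1)) = (mk (wires 1) ⊠ mk (Z 1 0 0)) ⊠ mk (wires 1) from (par_assoc' _ _ _).trans (cast_id _ _ _),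
    ← seq_par_wires, Z_seq_par_Z 1 1 1 0 le_rfl, add_zero (0 : ZMod 8), Z_one_one, wires_par_wires, id_seq, ← wires_par_seq,
    Z_par_seq_Z 0 1 1 1 le_rfl, add_zero (0 : ZMod 8), Z_one_one, wires_par_wires]

/-! ### Continuation forms (for rewriting on right-nested spines) -/

/-- `swap_seq_czGadget` followed by anything. [cite: JeandelPerdrixVilmart2018, §2.2] -/
theorem swap_seq_czGadget_cont {k : ℕ} (R : ZXClass 2 k) :
    mk swap ⨟ ((mk (Z 1 2 0) ⊠ mk (wires 1)) ⨟ (((mk (wires 1) ⊠ mk hBox) ⊠ mk (wires 1)) ⨟ ((mk (wires 1) ⊠ mk (Z 2 1 0)) ⨟ R))) =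
      (mk (Z 1 2 0) ⊠ mk (wires 1)) ⨟ (((mk (wires 1) ⊠ mk hBox) ⊠ mk (wires 1)) ⨟ ((mk (wires 1) ⊠ mk (Z 2 1 0)) ⨟ (mk swap ⨟ R))) := by
  have h := congrArg (· ⨟ R) swap_seq_czGadget
  simpa only [seq_assoc] using h

/-- `czGadget_eq_hedgeSq` followed by anything. [cite: JeandelPerdrixVilmart2018, §2.2] -/
theorem czGadget_eq_hedgeSq_cont {k : ℕ} (R : ZXClass 2 k) :
    (mk (Z 1 2 0) ⊠ mk (wires 1)) ⨟ (((mk (wires 1) ⊠ mk hBox) ⊠ mk (wires 1)) ⨟ ((mk (wires 1) ⊠ mk (Z 2 1 0)) ⨟ R)) =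
      (mk (Z 1 2 0) ⊠ mk (Z 1 2 0)) ⨟ (((mk (wires 1) ⊠ ((mk hBox ⊠ mk (wires 1)) ⨟ mk cap)) ⊠ mk (wires 1)) ⨟ R) := by
  have h := congrArg (· ⨟ R) czGadget_eq_hedgeSq
  simpa only [seq_assoc] using h

/-- `hedgeSq_seq_phases` followed by anything. [cite: JeandelPerdrixVilmart2018, Fig. 1 (S1)] -/
theorem hedgeSq_seq_phases_cont {k : ℕ} (a b : ZMod 8) (R : ZXClass 2 k) :
    (mk (Z 1 2 0) ⊠ mk (Z 1 2 0)) ⨟ (((mk (wires 1) ⊠ ((mk hBox ⊠ mk (wires 1)) ⨟ mk cap)) ⊠ mk (wires 1)) ⨟ ((mk (Z 1 1 a) ⊠ mk (Z 1 1 b)) ⨟ R)) =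
      (mk (Z 1 2 a) ⊠ mk (Z 1 2 b)) ⨟ (((mk (wires 1) ⊠ ((mk hBox ⊠ mk (wires 1)) ⨟ mk cap)) ⊠ mk (wires 1)) ⨟ R) := by
  have h := congrArg (· ⨟ R) (hedgeSq_seq_phases a b)
  simpa only [seq_assoc] using h

/-- `phases_seq_hedgeSq` followed by anything. [cite: JeandelPerdrixVilmart2018, Fig. 1 (S1)] -/
theorem phases_seq_hedgeSq_cont {k : ℕ} (a b : ZMod 8) (R : ZXClass 2 k) :
    (mk (Z 1 1 a) ⊠ mk (Z 1 1 b)) ⨟ ((mk (Z 1 2 0) ⊠ mk (Z 1 2 0)) ⨟ (((mk (wires 1) ⊠ ((mk hBox ⊠ mk (wires 1)) ⨟ mk cap)) ⊠ mk (wires 1)) ⨟ R)) =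
      (mk (Z 1 2 a) ⊠ mk (Z 1 2 b)) ⨟ (((mk (wires 1) ⊠ ((mk hBox ⊠ mk (wires 1)) ⨟ mk cap)) ⊠ mk (wires 1)) ⨟ R) := by
  have h := congrArg (· ⨟ R) (phases_seq_hedgeSq a b)
  simpa only [seq_assoc] using h

/-- The square lemma between a `2 → 2` prefix and a `2 → 1` continuation, on a right-nested spine. [cite: JeandelPerdrixVilmart2018, Appendix Lemma 18 (proof)] -/
theorem sqrt_two_sq_par_czGadget_sq_cont (P : ZXClass 2 2) (R : ZXClass 2 1) :
    mk (dumbbell 0 0) ⊠ (mk (dumbbell 0 0) ⊠ (P ⨟ ((mk (Z 1 2 0) ⊠ mk (wires 1)) ⨟ (((mk (wires 1) ⊠ mk hBox) ⊠ mk (wires 1)) ⨟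
      ((mk (wires 1) ⊠ mk (Z 2 1 0)) ⨟ ((mk (Z 1 2 0) ⊠ mk (wires 1)) ⨟ (((mk (wires 1) ⊠ mk hBox) ⊠ mk (wires 1)) ⨟
      ((mk (wires 1) ⊠ mk (Z 2 1 0)) ⨟ R)))))))) = P ⨟ R := by
  have h := congrArg (fun Q : ZXClass 2 2 => P ⨟ Q ⨟ R) sqrt_two_sq_par_czGadget_seq_czGadget
  rw [seq_id] at h
  rw [← h, two_two_seq_scalar_par_two, two_two_seq_scalar_par_two, scalar_par_two_two_seq_one, scalar_par_two_two_seq_one]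
  simp only [seq_assoc]

/-! ### LMCS Lemma 18 (C1-bis) -/

/-- **LMCS Lemma 18 = JPV's Lemma (C1-bis)**: the two red nodes on the inputs joined by a
Hadamard wire, together with the scalar `√2`, are absorbed by the gadget "green `α` and `β`,
red `π` carrying a green `α` leaf, red node carrying a green `β` leaf, green merge":
`√2 ⊗ (((X^{(1,2)} ⊗ 𝕀) ⨾ (𝕀 ⊗ ((H ⊗ 𝕀) ⨾ X^{(2,1)}))) ⨾ C(α,β)) = C(α,β)`.
[cite: JeandelPerdrixVilmart2018, Appendix Lemma 18] -/
theorem c1bis (a b : ZMod 8) :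
    mk (dumbbell 0 0) ⊠ (((mk (X 1 2 0) ⊠ mk (wires 1)) ⨟ (mk (wires 1) ⊠ ((mk hBox ⊠ mk (wires 1)) ⨟ mk (X 2 1 0)))) ⨟
      ((mk (Z 1 1 a) ⊠ mk (Z 1 1 b)) ⨟ (mk (xLeafL 4 a) ⊠ mk (xLeafR 0 b)) ⨟ mk (Z 2 1 0))) =
      (mk (Z 1 1 a) ⊠ mk (Z 1 1 b)) ⨟ (mk (xLeafL 4 a) ⊠ mk (xLeafR 0 b)) ⨟ mk (Z 2 1 0) := by
  rw [xsplits_hWire_eq_square, scalar_par_two_two_seq_one]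
  simp only [seq_assoc]
  -- s1: the crossing passes the two Hadamards; s2: and the second gadget
  rw [← seq_assoc (mk swap) (mk hBox ⊠ mk hBox), ← hBox_par_hBox_seq_swap, seq_assoc (mk hBox ⊠ mk hBox) (mk swap),
    swap_seq_czGadget_cont]
  -- s3: the crossing passes the phases and the leaves and is absorbed by the merge
  rw [← seq_assoc (mk swap) (mk (Z 1 1 a) ⊠ mk (Z 1 1 b)), swap_seq_par_one_one, seq_assoc _ (mk swap),
    ← seq_assoc (mk swap) (mk (xLeafL 4 a) ⊠ mk (xLeafR 0 b)), swap_seq_par_one_one, seq_assoc _ (mk swap), swap_spider]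
  conv_lhs => rw [← xLeafL_eq_xLeafR 0 b, xLeafL_eq_xLeafR 4 a]
  -- s5: both gadgets in cap form; s6: the swapped phases enter the second gadget
  rw [czGadget_eq_hedgeSq_cont, czGadget_eq_hedgeSq_cont, hedgeSq_seq_phases_cont]
  -- s7: (C1) backwards on the lower gadget, with the second Hadamard; then `H ∘ H = 𝕀`
  rw [par_eq_seq_left (mk hBox) (mk hBox), seq_assoc (mk hBox ⊠ mk (wires 1)),
    show (mk (wires 1) ⊠ mk hBox) ⨟ ((mk (Z 1 2 b) ⊠ mk (Z 1 2 a)) ⨟ (((mk (wires 1) ⊠ ((mk hBox ⊠ mk (wires 1)) ⨟ mk cap)) ⊠ mk (wires 1)) ⨟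
        ((mk (xLeafL 0 b) ⊠ mk (xLeafR 4 a)) ⨟ mk (Z 2 1 0)))) =
      (mk hBox ⊠ mk (wires 1)) ⨟ ((mk (Z 1 2 a) ⊠ mk (Z 1 2 b)) ⨟ (((mk (wires 1) ⊠ ((mk hBox ⊠ mk (wires 1)) ⨟ mk cap)) ⊠ mk (wires 1)) ⨟
        ((mk (xLeafL 4 a) ⊠ mk (xLeafR 0 b)) ⨟ mk (Z 2 1 0)))) from by simpa only [seq_assoc] using (c1Gadget_eq_mirror a b).symm,
    ← seq_assoc (mk hBox ⊠ mk (wires 1)) (mk hBox ⊠ mk (wires 1)), hBox_par_seq_hBox_par, id_seq]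
  -- s9: the phases leave the lower gadget upwards and pass the upper one
  rw [← phases_seq_hedgeSq_cont a b, hedgeSq_seq_phases_cont a b, ← phases_seq_hedgeSq_cont a b]
  -- s10: the square of the gadget with `√2 ⊗ √2`
  rw [← czGadget_eq_hedgeSq_cont, ← czGadget_eq_hedgeSq_cont, sqrt_two_sq_par_czGadget_sq_cont]

end ZXClass

end Literature.Computability.QuantumComplexity
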